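import Summits.Ventures.Crystal3D.Bulk.RotSysEuler
import HarnessLib

/-!
# Regions of a sub-rotation-system: the faces of a connected sub-map of a planar map ARE the
# regions it cuts the ambient surface into (generic brick for `phase2/LEAN-FACES-DESIGN.md` (F2)(i)/(F3))

HONEST FRAMING. Part of the venture `Summits/Ventures/Crystal3D` (cell `pub-crystal3d`, phase 2;
seat typer-bulk-2), generic and geometry-free (namespace `RotSys`, on top of the (G1) bricks
`Bulk/RotSys{Induce,Counts,Delete,Swap,Merge,DeleteK,DeleteF,Euler}.lean`). Nothing here mentions
GAP(1.26).

Setting: a loopless rotation system `(σ, α)` on a finite dart type `D` (`IsRotSys σ α`): the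
AMBIENT map is the full dart set `univ` (for the GAP census: the fan triangulation of the hull of
the thirteen directions, `Bulk/HullRotSysEuler.lean`), a sub-map is an `α`-closed `S : Finset D`
with the induced rotation (`induce σ S`) and face permutation `phi σ α S` (`Bulk/RotSysCounts`).
Deleting the edges not in `S` from the ambient map glues ambient faces together; the glued classes
are the REGIONS of `S`:

* `regStep σ α S x y` — one gluing step: `y = σ (α x)` (next dart of the same AMBIENT face) or
  `x ∉ S ∧ y = α x` (cross a deleted edge); `regRel σ α S` — its equivalence closure, the
  **region relation**; its classes on `univ` are the regions;
* `regRel_phi` — consecutive darts of a face of `S` lie in one region (the first-return walk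
  of `σ` from `α x` to `S` crosses only deleted edges), hence `regRel_of_sameCycle_phi`: every
  face of `S` lies in ONE region; `regRel_mono`; `regRel_univ_iff` (the regions of the full map
  are its faces); `regRel_sdiff_iff` — deleting one more edge `{d, α d}` glues exactly the
  region(s) of `d` and `α d`;
* **`IsRotSys.regRel_iff_sameCycle_phi`**, **`IsRotSys.exists_mem_regRel`** — THE THEOREM: if the
  ambient map is planar and connected (`chi2 σ α univ = 4`, `numK σ α univ = 1`) and `S` is
  `α`-closed and CONNECTED (`numK σ α S = 1`), then two darts of `S` lie in the same region iff
  they lie on the same face of `S`, and every region contains a dart of `S`: **faces of `S` ↔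
  regions of `S`, bijectively** («every face is a disc with one boundary walk»). Proof: induction
  on the number of deleted darts, growing `S` by an ambient edge at one of its vertices (exists:
  `exists_sameCycle_not_mem`); deleting that edge back MERGES two faces and the two regions
  (`sameCycle_swap_mul_iff_merge`, `regRel_sdiff_iff`), or removes a PENDANT edge (faces and
  regions unchanged as partitions of the smaller set), while a non-pendant SPLIT would disconnect
  `S` (excluded by planarity `chi2_eq_of_subset` and `numK S = 1`);
* `IsRotSys.numClasses_regRel_eq_numF` — hence `#regions = numF σ α S`.

For the GAP census (`Bulk/GapFaceRegions.lean`, next): the oriented faces of the connected tight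
map are in bijection with the classes of fan triangles of the thirteen directions glued along
non-tight hull edges — the object Lemma L / the face-size rows are about.
-/

namespace Summit.Ventures.Crystal3D

namespace RotSys

open Equiv Equiv.Perm Finset

variable {D : Type*} [DecidableEq D] [Fintype D]

/-! ## The region relation -/

omit [DecidableEq D] [Fintype D] in
/-- One gluing step of the region relation of `S`: move to the next dart of the same AMBIENT
face (`y = σ (α x)`), or cross an edge that is NOT in `S` (`x ∉ S`, `y = α x`). -/
def regStep (σ α : Perm D) (S : Finset D) (x y : D) : Prop :=
  y = σ (α x) ∨ (x ∉ S ∧ y = α x)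

omit [DecidableEq D] [Fintype D] in
/-- **The region relation of the sub-rotation-system `S`**: the equivalence closure of
`regStep`. Its classes (on all darts) are the REGIONS into which `S` cuts the ambient map. -/
def regRel (σ α : Perm D) (S : Finset D) : D → D → Prop :=
  Relation.EqvGen (regStep σ α S)

variable {σ α : Perm D} {S : Finset D}

omit [DecidableEq D] [Fintype D] in
/-- `regRel` is reflexive. -/
theorem regRel_refl (σ α : Perm D) (S : Finset D) (x : D) : regRel σ α S x x :=
  Relation.EqvGen.refl x

omit [DecidableEq D] [Fintype D] in
/-- `regRel` is symmetric. -/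
theorem regRel_symm {x y : D} (hxy : regRel σ α S x y) : regRel σ α S y x :=
  Relation.EqvGen.symm x y hxy

omit [DecidableEq D] [Fintype D] in
/-- `regRel` is transitive. -/
theorem regRel_trans {x y z : D} (h1 : regRel σ α S x y) (h2 : regRel σ α S y z) :
    regRel σ α S x z :=
  Relation.EqvGen.trans x y z h1 h2

omit [DecidableEq D] [Fintype D] in
/-- Ambient face step: `x ~ σ (α x)`. -/
theorem regRel_full_step (σ α : Perm D) (S : Finset D) (x : D) : regRel σ α S x (σ (α x)) :=
  Relation.EqvGen.rel x _ (Or.inl rfl)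

omit [DecidableEq D] [Fintype D] in
/-- Crossing a deleted edge: `x ∉ S → x ~ α x`. -/
theorem regRel_alpha (σ : Perm D) {α : Perm D} {S : Finset D} {x : D} (hx : x ∉ S) :
    regRel σ α S x (α x) :=
  Relation.EqvGen.rel x _ (Or.inr ⟨hx, rfl⟩)

omit [DecidableEq D] in
/-- Darts on a common AMBIENT face (`(σ * α)`-cycle) are region-related. -/
theorem regRel_of_sameCycle_full {x y : D} (hxy : (σ * α).SameCycle x y) : regRel σ α S x y := by
  obtain ⟨n, hn⟩ := hxy.exists_nat_pow_eq
  rw [← hn]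
  clear hn
  induction n with
  | zero => simpa using regRel_refl σ α S x
  | succ n ih =>
    rw [pow_succ', Perm.mul_apply, Perm.mul_apply]
    exact regRel_trans ih (regRel_full_step σ α S _)

omit [DecidableEq D] [Fintype D] in
/-- **Monotonicity**: deleting more edges only glues more — for `T ⊆ S`, `regRel S ≤ regRel T`. -/
theorem regRel_mono {T : Finset D} (hTS : T ⊆ S) {x y : D} (hxy : regRel σ α S x y) :
    regRel σ α T x y := by
  induction hxy with
  | rel a b hab =>
    rcases hab with h1 | ⟨ha, h2⟩
    · exact h1 ▸ regRel_full_step σ α T a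
    · exact h2 ▸ regRel_alpha σ (fun haT => ha (hTS haT))
  | refl a => exact regRel_refl σ α T a
  | symm a b _ ih => exact regRel_symm ih
  | trans a b c _ _ ih1 ih2 => exact regRel_trans ih1 ih2

/-- **A face of `S` stays in one region**: `x ~ φ_S x`. For `x ∈ S` the face successor is the
first return `σ^r (α x)` of `σ` to `S`; the intermediate darts `σ^i (α x)` (`0 < i < r`) are
NOT in `S`, so the walk `α x → σ (α x) → α σ (α x) → σ σ (α x) → …` alternates ambient face
steps and deleted-edge crossings. For `x ∉ S` (so `α x ∉ S`), `φ_S x = α x`. -/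
theorem regRel_phi (h : IsRotSys σ α) (hS : IsClosed α S) (x : D) :
    regRel σ α S x (phi σ α S x) := by
  rw [phi_apply]
  by_cases hx : x ∈ S
  · have hαx : α x ∈ S := hS x hx
    rw [induce_apply_of_mem σ hαx]
    set r := retTime σ S (α x) with hr
    have hr0 : 0 < r := (retTime_spec σ hαx).1
    -- `x ~ σ^i (α x)` for `1 ≤ i ≤ r`
    have key : ∀ i : ℕ, 1 ≤ i → i ≤ r → regRel σ α S x ((σ ^ i) (α x)) := by
      intro i
      induction i with
      | zero => intro h0; exact absurd h0 (by omega)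
      | succ i ih =>
        intro _ hir
        rcases Nat.eq_zero_or_pos i with h0 | hpos
        · subst h0
          rw [zero_add, pow_one]
          exact regRel_full_step σ α S x
        · have hprev := ih hpos (by omega)
          have hnot : (σ ^ i) (α x) ∉ S := pow_not_mem_of_lt_retTime σ hαx hpos (by omega)
          have h1 : regRel σ α S ((σ ^ i) (α x)) (α ((σ ^ i) (α x))) := regRel_alpha σ hnot
          have h2 := regRel_full_step σ α S (α ((σ ^ i) (α x)))
          rw [h.α_inv] at h2
          rw [pow_succ', Perm.mul_apply]
          exact regRel_trans hprev (regRel_trans h1 h2)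
    exact key r hr0 le_rfl
  · have hαx : α x ∉ S := fun hmem => hx (by have := hS _ hmem; rwa [h.α_inv] at this)
    rw [induce_apply_of_not_mem σ hαx]
    exact regRel_alpha σ hx

/-- Powers: `x ~ φ_S^k x`. -/
theorem regRel_phi_pow (h : IsRotSys σ α) (hS : IsClosed α S) (x : D) (k : ℕ) :
    regRel σ α S x ((phi σ α S ^ k) x) := by
  induction k with
  | zero => simpa using regRel_refl σ α S x
  | succ k ih =>
    rw [pow_succ', Perm.mul_apply]
    exact regRel_trans ih (regRel_phi h hS _)

/-- **Every face of `S` lies in one region.** -/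
theorem regRel_of_sameCycle_phi (h : IsRotSys σ α) (hS : IsClosed α S) {x y : D}
    (hxy : (phi σ α S).SameCycle x y) : regRel σ α S x y := by
  obtain ⟨k, hk⟩ := hxy.exists_nat_pow_eq
  rw [← hk]
  exact regRel_phi_pow h hS x k

/-- On the full dart set the induced rotation is `σ`. -/
theorem induce_univ (σ : Perm D) : induce σ (univ : Finset D) = σ := by
  ext x
  exact induce_eq_of_first_return σ (mem_univ x) Nat.one_pos (by rw [pow_one]) (mem_univ _)
    (fun m hm0 hm1 => absurd hm1 (by omega))

/-- The face permutation of the full dart set is `σ * α`. -/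
theorem phi_univ (σ α : Perm D) : phi σ α (univ : Finset D) = σ * α := by
  unfold phi; rw [induce_univ]

omit [DecidableEq D] in
/-- **The regions of the full map are its faces.** -/
theorem regRel_univ_iff (x y : D) :
    regRel σ α (univ : Finset D) x y ↔ (σ * α).SameCycle x y := by
  refine ⟨fun hxy => ?_, regRel_of_sameCycle_full⟩
  induction hxy with
  | rel a b hab =>
    rcases hab with h1 | ⟨ha, -⟩
    · exact ⟨(1 : ℕ), by rw [zpow_natCast, pow_one, Perm.mul_apply, h1]⟩
    · exact absurd (mem_univ a) ha
  | refl a => exact SameCycle.refl _ a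
  | symm a b _ ih => exact ih.symm
  | trans a b c _ _ ih1 ih2 => exact ih1.trans ih2

omit [Fintype D] in
/-- The three-way relation used in `regRel_sdiff_iff`. -/
private theorem regRel_sdiff_aux (h : IsRotSys σ α) (d : D) {x y : D}
    (hxy : regRel σ α (S \ {d, α d}) x y) :
    regRel σ α S x y ∨ (regRel σ α S x d ∧ regRel σ α S (α d) y) ∨
      (regRel σ α S x (α d) ∧ regRel σ α S d y) := by
  induction hxy with
  | rel a b hab =>
    rcases hab with h1 | ⟨ha, h2⟩
    · exact Or.inl (h1 ▸ regRel_full_step σ α S a)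
    · by_cases haS : a ∈ S
      · -- `a ∈ S`, `a ∉ S \ e`: `a = d` or `a = α d`
        have : a = d ∨ a = α d := by
          by_contra hne
          rw [not_or] at hne
          exact ha (mem_sdiff.2 ⟨haS, by simp [hne.1, hne.2]⟩)
        rcases this with rfl | rfl
        · exact Or.inr (Or.inl ⟨regRel_refl σ α S _, h2 ▸ regRel_refl σ α S _⟩)
        · refine Or.inr (Or.inr ⟨regRel_refl σ α S _, ?_⟩)
          rw [h2, h.α_inv]; exact regRel_refl σ α S _
      · exact Or.inl (h2 ▸ regRel_alpha σ haS)
  | refl a => exact Or.inl (regRel_refl σ α S a)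
  | symm a b _ ih =>
    rcases ih with h1 | ⟨h2, h3⟩ | ⟨h2, h3⟩
    · exact Or.inl (regRel_symm h1)
    · exact Or.inr (Or.inr ⟨regRel_symm h3, regRel_symm h2⟩)
    · exact Or.inr (Or.inl ⟨regRel_symm h3, regRel_symm h2⟩)
  | trans a b c _ _ ih1 ih2 =>
    rcases ih1 with p1 | ⟨p2, p3⟩ | ⟨p2, p3⟩
    · rcases ih2 with q1 | ⟨q2, q3⟩ | ⟨q2, q3⟩
      · exact Or.inl (regRel_trans p1 q1)
      · exact Or.inr (Or.inl ⟨regRel_trans p1 q2, q3⟩)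
      · exact Or.inr (Or.inr ⟨regRel_trans p1 q2, q3⟩)
    · rcases ih2 with q1 | ⟨-, q3⟩ | ⟨-, q3⟩
      · exact Or.inr (Or.inl ⟨p2, regRel_trans p3 q1⟩)
      · exact Or.inr (Or.inl ⟨p2, q3⟩)
      · exact Or.inl (regRel_trans p2 q3)
    · rcases ih2 with q1 | ⟨-, q3⟩ | ⟨-, q3⟩
      · exact Or.inr (Or.inr ⟨p2, regRel_trans p3 q1⟩)
      · exact Or.inl (regRel_trans p2 q3)
      · exact Or.inr (Or.inr ⟨p2, q3⟩)

omit [Fintype D] in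
/-- **Deleting one more edge glues exactly the regions of its two darts**: for the edge
`{d, α d}`, two darts are region-related for `S \ {d, α d}` iff they are region-related for `S`,
or one is `S`-related to `d` and the other to `α d`. -/
theorem regRel_sdiff_iff (h : IsRotSys σ α) (d x y : D) :
    regRel σ α (S \ {d, α d}) x y ↔
      regRel σ α S x y ∨ (regRel σ α S x d ∧ regRel σ α S (α d) y) ∨
        (regRel σ α S x (α d) ∧ regRel σ α S d y) := by
  refine ⟨regRel_sdiff_aux h d, fun hxy => ?_⟩
  have hsub : S \ {d, α d} ⊆ S := sdiff_subset
  have hdα : regRel σ α (S \ {d, α d}) d (α d) := regRel_alpha σ (by simp)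
  rcases hxy with h1 | ⟨h2, h3⟩ | ⟨h2, h3⟩
  · exact regRel_mono hsub h1
  · exact regRel_trans (regRel_mono hsub h2) (regRel_trans hdα (regRel_mono hsub h3))
  · refine regRel_trans (regRel_mono hsub h2) (regRel_trans (regRel_symm ?_) (regRel_mono hsub h3))
    exact hdα

end RotSys

end Summit.Ventures.Crystal3D
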